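import Literature.RepresentationTheory.HarrisKudlaSweet1996.SplittingCharactersCM
import HarnessLib

/-!
# Splitting characters with PRESCRIBED archimedean types, as data

Sequel of `SplittingCharactersCM` (pub-hodgecm MODEL-CONSTRUCTION sub-cell, node W2-iii; the leaf
"`SplittingCharacters.ofArchType`" of the W2 hand-off).  For a CM field `L` and tuples `e_V, e_W : (w ∣ ∞) → ℤ`
with `e_V ≡ m`, `e_W ≡ n (mod 2)` the kernel existence theorem
`exists_splittingCharacters_hasUnitaryArchType` ([HarrisKudlaSweet1996, (1.5) p. 951] splitting data with the
parity-compatible ∞-types of [Liu2021, Remark 4.2]) is turned into DATA by a choice on a kernel-proved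
existential (no cited existential, no record):

* `splittingCharOfArchType L m e he : HeckeCharacter L` — ONE unitary Hecke character with
  `χ|_{𝕀_{L⁺}} = ε_{L/L⁺}^m` and unitary archimedean type `(e, 0)` (`isUnitary_…`, `isSplittingChar_…`,
  `hasUnitaryArchType_…`);
* `SplittingCharacters.ofArchType L m n eV eW hV hW : SplittingCharacters L m n` — a PAIR `(χ_V, χ_W)` of
  splitting characters with `χ_V` of type `(e_V, 0)` and `χ_W` of type `(e_W, 0)`
  (`hasUnitaryArchType_ofArchType_χV/χW`), whose ∞-type functions are the prescribed tuples:
  `archTypeV_ofArchType : (ofArchType …).archTypeV = eV`, `archTypeW_ofArchType : … = eW`.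

The parity hypotheses are necessary (`IsSplittingChar.modEq_of_hasUnitaryArchType` in the prequel).

## References

* M. Harris, S. Kudla, W. J. Sweet, *Theta dichotomy for unitary groups*, J. Amer. Math. Soc. 9 (1996),
  941–1004 — (1.5) p. 951. [HarrisKudlaSweet1996]
* Y. Liu, *Fourier–Jacobi cycles and arithmetic relative trace formula*, Camb. J. Math. 9 (2021), no. 1,
  1–147, arXiv:2102.11518 — §4.1 Remark 4.2. [Liu2021]
-/

set_option autoImplicit false

noncomputable section

open NumberField NumberField.InfinitePlace

namespace Literature.RepresentationTheory.HarrisKudlaSweet1996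

open _root_.Literature.NumberTheory.GaloisRepresentations (HeckeCharacter)

variable (L : Type) [Field L] [NumberField L] [IsCMField L]

/-! ## § 1. One splitting character of prescribed ∞-type -/

/-- **A splitting character of prescribed archimedean type** (data): for `e_w ≡ m (mod 2)`, a unitary Hecke
character `χ` of `L` with `χ|_{𝕀_{L⁺}} = ε_{L/L⁺}^m` and unitary archimedean type `(e, 0)`, chosen from the
kernel existence theorem `exists_isSplittingChar_hasUnitaryArchType`. [cite: HarrisKudlaSweet1996, (1.5) p. 951] -/
def splittingCharOfArchType (m : ℕ) (e : InfinitePlace L → ℤ) (he : ∀ w, e w ≡ (m : ℤ) [ZMOD 2]) :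
    HeckeCharacter L :=
  (exists_isSplittingChar_hasUnitaryArchType L m e he).choose

/-- `splittingCharOfArchType` is unitary. [folklore] -/
theorem isUnitary_splittingCharOfArchType (m : ℕ) (e : InfinitePlace L → ℤ) (he : ∀ w, e w ≡ (m : ℤ) [ZMOD 2]) :
    (splittingCharOfArchType L m e he).IsUnitary :=
  (exists_isSplittingChar_hasUnitaryArchType L m e he).choose_spec.1

/-- `splittingCharOfArchType` satisfies the splitting condition (1.5): `χ|_{𝕀_{L⁺}} = ε^m`.
[cite: HarrisKudlaSweet1996, (1.5) p. 951] -/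
theorem isSplittingChar_splittingCharOfArchType (m : ℕ) (e : InfinitePlace L → ℤ)
    (he : ∀ w, e w ≡ (m : ℤ) [ZMOD 2]) : IsSplittingChar L m (splittingCharOfArchType L m e he) :=
  (exists_isSplittingChar_hasUnitaryArchType L m e he).choose_spec.2.1

/-- `splittingCharOfArchType` has unitary archimedean type `(e, 0)`. [folklore] -/
theorem hasUnitaryArchType_splittingCharOfArchType (m : ℕ) (e : InfinitePlace L → ℤ)
    (he : ∀ w, e w ≡ (m : ℤ) [ZMOD 2]) : (splittingCharOfArchType L m e he).HasUnitaryArchType e 0 :=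
  (exists_isSplittingChar_hasUnitaryArchType L m e he).choose_spec.2.2

/-! ## § 2. Splitting data `(χ_V, χ_W)` of prescribed ∞-types -/

namespace SplittingCharacters

/-- **Splitting data with prescribed archimedean types** (data): for `e_V ≡ m`, `e_W ≡ n (mod 2)`, a pair of
splitting characters `(χ_V, χ_W) : SplittingCharacters L m n` with `χ_V` of unitary archimedean type `(e_V, 0)`
and `χ_W` of type `(e_W, 0)`, chosen from the kernel existence theorem
`exists_splittingCharacters_hasUnitaryArchType`. [cite: HarrisKudlaSweet1996, (1.5) p. 951] -/
def ofArchType (m n : ℕ) (eV eW : InfinitePlace L → ℤ) (hV : ∀ w, eV w ≡ (m : ℤ) [ZMOD 2])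
    (hW : ∀ w, eW w ≡ (n : ℤ) [ZMOD 2]) : SplittingCharacters L m n :=
  (exists_splittingCharacters_hasUnitaryArchType L m n eV eW hV hW).choose

variable {L}

/-- `χ_V` of `ofArchType` has unitary archimedean type `(e_V, 0)`. [folklore] -/
theorem hasUnitaryArchType_ofArchType_χV (m n : ℕ) (eV eW : InfinitePlace L → ℤ)
    (hV : ∀ w, eV w ≡ (m : ℤ) [ZMOD 2]) (hW : ∀ w, eW w ≡ (n : ℤ) [ZMOD 2]) :
    (ofArchType L m n eV eW hV hW).χV.HasUnitaryArchType eV 0 :=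
  (exists_splittingCharacters_hasUnitaryArchType L m n eV eW hV hW).choose_spec.1

/-- `χ_W` of `ofArchType` has unitary archimedean type `(e_W, 0)`. [folklore] -/
theorem hasUnitaryArchType_ofArchType_χW (m n : ℕ) (eV eW : InfinitePlace L → ℤ)
    (hV : ∀ w, eV w ≡ (m : ℤ) [ZMOD 2]) (hW : ∀ w, eW w ≡ (n : ℤ) [ZMOD 2]) :
    (ofArchType L m n eV eW hV hW).χW.HasUnitaryArchType eW 0 :=
  (exists_splittingCharacters_hasUnitaryArchType L m n eV eW hV hW).choose_spec.2

/-- The ∞-type function of `χ_V` returns the prescribed tuple: `(ofArchType … eV eW …).archTypeV = eV`. [folklore] -/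
@[simp] theorem archTypeV_ofArchType (m n : ℕ) (eV eW : InfinitePlace L → ℤ)
    (hV : ∀ w, eV w ≡ (m : ℤ) [ZMOD 2]) (hW : ∀ w, eW w ≡ (n : ℤ) [ZMOD 2]) :
    (ofArchType L m n eV eW hV hW).archTypeV = eV :=
  archTypeV_eq _ (hasUnitaryArchType_ofArchType_χV m n eV eW hV hW)

/-- The ∞-type function of `χ_W` returns the prescribed tuple: `(ofArchType … eV eW …).archTypeW = eW`. [folklore] -/
@[simp] theorem archTypeW_ofArchType (m n : ℕ) (eV eW : InfinitePlace L → ℤ)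
    (hV : ∀ w, eV w ≡ (m : ℤ) [ZMOD 2]) (hW : ∀ w, eW w ≡ (n : ℤ) [ZMOD 2]) :
    (ofArchType L m n eV eW hV hW).archTypeW = eW :=
  archTypeW_eq _ (hasUnitaryArchType_ofArchType_χW m n eV eW hV hW)

end SplittingCharacters

end Literature.RepresentationTheory.HarrisKudlaSweet1996

end
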